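import Literature.AlgebraicGeometry.Motives.HodgeLieDiagonal
import Literature.AlgebraicGeometry.Motives.HodgeStructureK3Type
import HarnessLib

/-!
# The centre `𝔷 = 𝔥 ∩ End_Hdg` and the derived algebra `[𝔥, 𝔥]` of the Hodge Lie algebra under isomorphism and under powers:
# `𝔷(e^* H) = e⁻¹ 𝔷(H) e`, `𝔷(H^{⊕ι}) = Δ 𝔷(H)`, and the same for `[𝔥, 𝔥]`; equal dimensions

Family `hodge`, layer `Literature/AlgebraicGeometry/Motives`; THEOREMS ONLY (no definition, no named fact; net debt 0).
Written for the cell `pub-hodgecm2` (COR-CM), seat `b27` gen 43 (count-neutral Mumford–Tate-rank ladder).  Companion of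
`Motives/HodgeLieIsomorphismInvariance` (`𝔥(e^* H) = e⁻¹ 𝔥(H) e`, `𝔥(H^{⊕ι}) = Δ 𝔥(H)` as Lie algebras; not imported — the
one lemma needed from it is re-proved privately, so that this file depends only on `Motives/HodgeLieDiagonal`).  The ladder
reads two numerical invariants of the reductive Lie algebra `𝔥 = Lie Hg` besides its dimension: the dimension of the
centre `𝔷 = 𝔥 ∩ End_Hdg` (`HodgeThetaSubalgebraReductive`: `= 𝔥 ∩ centralizer(𝔥)`; for `H¹` of an abelian variety, the
type-IV part) and of the derived algebra `𝔡 = span {XY − YX}` (the semisimple part).  Here both are shown invariant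
under transport along a linear isomorphism of Hodge structures and under `H ↦ H^{⊕ι}` — the Lie-algebra content of
«`MT(W) = φ MT(V) φ⁻¹`», «`MT(V^{⊕n}) ≅ MT(V)` acting diagonally» [Moonen 1999 (1.7)–(1.8)] for the centre and the derived
group; for abelian varieties: the centre and the semisimple part of `Hg` have the same dimension for isogenous varieties
and for `B` and `Bⁿ` (Moonen–Zarhin 1999 §1).

* §1 `mem_endAlg_comapEquiv_iff` (`a ∈ End_Hdg(e^* H) ↔ e a e⁻¹ ∈ End_Hdg(H)`), `hodgeLie_inf_endAlg_comapEquiv_eq_map_conj`,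
  **`finrank_hodgeLie_inf_endAlg_comapEquiv`**, `hodgeLie_derived_comapEquiv_eq_map_conj`,
  **`finrank_hodgeLie_derived_comapEquiv`**.
* §2 `hodgeLie_inf_endAlg_pi_const_eq_map_diagonal`, **`finrank_hodgeLie_inf_endAlg_pi_const_eq`**,
  `hodgeLie_derived_pi_const_eq_map_diagonal`, **`finrank_hodgeLie_derived_pi_const_eq`**.

## References
* [Moonen1999MTNotes] B. Moonen, *Notes on Mumford–Tate groups* (1999), (1.7)–(1.8). [cite: Moonen1999MTNotes, (1.7) and (1.8)]
* [MoonenZarhin1999LowDim] B. Moonen, Yu. Zarhin, Math. Ann. 315 (1999), §1 («we can identify `Hg(Xⁿ)` with `Hg(X)` acting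
  diagonally»; «`Hg(X)` is semi-simple» iff no factor of type 4) [corpus: paper:arxiv-math_9901113 p. 2]. [cite: MoonenZarhin1999LowDim, §1]
* [Deligne1982HodgeCycles] P. Deligne, LNM 900 (1982), I §3.1, Prop. 3.4 and Prop. 3.6. [cite: Deligne1982HodgeCycles, I §3 Prop. 3.6]
* [Huybrechts2016K3] D. Huybrechts, *Lectures on K3 Surfaces*, §3.3.3 (`End_Hdg`). [cite: Huybrechts2016K3, §3.3.3]
-/

noncomputable section

namespace Literature.AlgebraicGeometry.Motives

namespace HodgeStructure

/-! ### §1 Transport along `e : V ≃ W` -/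

section Transport

universe u

variable {V : Type u} [AddCommGroup V] [Module ℚ V] [Module.Finite ℚ V]
  {W : Type u} [AddCommGroup W] [Module ℚ W] [Module.Finite ℚ W] [HodgeTensorFacts.{u, u}] {n : ℤ}

/-- `𝔥(e^* H) = e⁻¹ 𝔥(H) e` as subspaces (private copy of `hodgeLie_comapEquiv_eq_map_conj` of
`Motives/HodgeLieIsomorphismInvariance`, so that this file imports only long-built modules).
[cite: Moonen1999MTNotes, (1.7) and (1.8)] -/
private theorem hodgeLie_comapEquiv_eq_map_conj' (H : HodgeStructure W n) (e : V ≃ₗ[ℚ] W) :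
    (H.comapEquiv e).hodgeLie =
      H.hodgeLie.map (e.symm.conj : Module.End ℚ W ≃ₗ[ℚ] Module.End ℚ V).toLinearMap := by
  refine le_antisymm (fun Y hY => ?_) ?_
  · refine ⟨e.toLinearMap ∘ₗ Y ∘ₗ e.symm.toLinearMap, conj_mem_hodgeLie_of_mem_hodgeLie_comapEquiv H e hY, ?_⟩
    change e.symm.conj _ = Y
    rw [LinearEquiv.conj_apply, LinearEquiv.symm_symm]
    ext v
    simp only [LinearMap.coe_comp, LinearEquiv.coe_coe, Function.comp_apply, LinearEquiv.symm_apply_apply]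
  · rintro _ ⟨X, hX, rfl⟩
    have h := conj_symm_mem_hodgeLie_comapEquiv H e hX
    change e.symm.conj X ∈ _
    rw [LinearEquiv.conj_apply, LinearEquiv.symm_symm, LinearMap.comp_assoc]
    exact h

omit [Module.Finite ℚ V] [Module.Finite ℚ W] [HodgeTensorFacts.{u, u}] in
/-- **`a ∈ End_Hdg(e^* H) ↔ e a e⁻¹ ∈ End_Hdg(H)`**: conjugation by the isomorphism of Hodge structures `e : e^* H ≅ H`
(`Hom.ofComapBaseChange` / `Hom.symmOfComapBaseChange`) identifies the endomorphism algebras. [cite: Huybrechts2016K3, §3.3.3]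
[cite: Moonen1999MTNotes, (1.7) and (1.8)] -/
theorem mem_endAlg_comapEquiv_iff (H : HodgeStructure W n) (e : V ≃ₗ[ℚ] W) (a : Module.End ℚ V) :
    a ∈ (H.comapEquiv e).endAlg ↔ e.toLinearMap ∘ₗ a ∘ₗ e.symm.toLinearMap ∈ H.endAlg := by
  constructor
  · intro ha
    exact Hom.toLinearMap_mem_endAlg
      ((Hom.ofComapBaseChange (H₁ := H.comapEquiv e) (H₂ := H) e fun _ => rfl).comp
        ((endAlg.toHom ⟨a, ha⟩).comp (Hom.symmOfComapBaseChange (H₁ := H.comapEquiv e) (H₂ := H) e fun _ => rfl)))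
  · intro ha
    have h := Hom.toLinearMap_mem_endAlg
      ((Hom.symmOfComapBaseChange (H₁ := H.comapEquiv e) (H₂ := H) e fun _ => rfl).comp
        ((endAlg.toHom ⟨_, ha⟩).comp (Hom.ofComapBaseChange (H₁ := H.comapEquiv e) (H₂ := H) e fun _ => rfl)))
    have heq : ((Hom.symmOfComapBaseChange (H₁ := H.comapEquiv e) (H₂ := H) e fun _ => rfl).comp
        ((endAlg.toHom ⟨_, ha⟩).comp
          (Hom.ofComapBaseChange (H₁ := H.comapEquiv e) (H₂ := H) e fun _ => rfl))).toLinearMap = a := by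
      refine LinearMap.ext fun v => ?_
      change e.symm ((e.toLinearMap ∘ₗ a ∘ₗ e.symm.toLinearMap) (e v)) = a v
      simp only [LinearMap.coe_comp, LinearEquiv.coe_coe, Function.comp_apply, LinearEquiv.symm_apply_apply]
    rwa [heq] at h

/-- **`𝔷(e^* H) = e⁻¹ 𝔷(H) e`** for the centre `𝔷 = 𝔥 ∩ End_Hdg` of the Hodge Lie algebra.
[cite: Moonen1999MTNotes, (1.7) and (1.8)] [cite: Deligne1982HodgeCycles, I §3 Prop. 3.6] -/
theorem hodgeLie_inf_endAlg_comapEquiv_eq_map_conj (H : HodgeStructure W n) (e : V ≃ₗ[ℚ] W) :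
    (H.comapEquiv e).hodgeLie ⊓ Subalgebra.toSubmodule (H.comapEquiv e).endAlg =
      (H.hodgeLie ⊓ Subalgebra.toSubmodule H.endAlg).map
        (e.symm.conj : Module.End ℚ W ≃ₗ[ℚ] Module.End ℚ V).toLinearMap := by
  have hconj : ∀ X : Module.End ℚ W, (e.symm.conj : Module.End ℚ W ≃ₗ[ℚ] Module.End ℚ V).toLinearMap X =
      e.symm.toLinearMap ∘ₗ X ∘ₗ e.toLinearMap := fun X => by
    change e.symm.conj X = _
    rw [LinearEquiv.conj_apply, LinearEquiv.symm_symm, LinearMap.comp_assoc]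
  have hback : ∀ Y : Module.End ℚ V,
      e.symm.toLinearMap ∘ₗ (e.toLinearMap ∘ₗ Y ∘ₗ e.symm.toLinearMap) ∘ₗ e.toLinearMap = Y := fun Y => by
    refine LinearMap.ext fun v => ?_
    simp only [LinearMap.coe_comp, LinearEquiv.coe_coe, Function.comp_apply, LinearEquiv.symm_apply_apply]
  refine le_antisymm (fun Y hY => ?_) ?_
  · obtain ⟨hY𝔥, hYe⟩ := Submodule.mem_inf.1 hY
    refine ⟨e.toLinearMap ∘ₗ Y ∘ₗ e.symm.toLinearMap, Submodule.mem_inf.2 ⟨?_, ?_⟩, ?_⟩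
    · exact conj_mem_hodgeLie_of_mem_hodgeLie_comapEquiv H e hY𝔥
    · exact (Subalgebra.mem_toSubmodule _).2
        ((mem_endAlg_comapEquiv_iff H e Y).1 ((Subalgebra.mem_toSubmodule _).1 hYe))
    · rw [hconj, hback]
  · rintro _ ⟨X, hX, rfl⟩
    obtain ⟨hX𝔥, hXe⟩ := Submodule.mem_inf.1 hX
    rw [hconj]
    refine Submodule.mem_inf.2 ⟨conj_symm_mem_hodgeLie_comapEquiv H e hX𝔥, (Subalgebra.mem_toSubmodule _).2 ?_⟩
    rw [mem_endAlg_comapEquiv_iff]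
    have heq : e.toLinearMap ∘ₗ (e.symm.toLinearMap ∘ₗ X ∘ₗ e.toLinearMap) ∘ₗ e.symm.toLinearMap = X := by
      refine LinearMap.ext fun w => ?_
      simp only [LinearMap.coe_comp, LinearEquiv.coe_coe, Function.comp_apply, LinearEquiv.apply_symm_apply]
    rw [heq]
    exact (Subalgebra.mem_toSubmodule _).1 hXe

/-- **`dim_ℚ 𝔷(e^* H) = dim_ℚ 𝔷(H)`** — the dimension of the centre of the Hodge Lie algebra (`𝔥 ∩ End_Hdg`) is an
invariant of the isomorphism class of the Hodge structure. [cite: Moonen1999MTNotes, (1.7) and (1.8)]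
[cite: Deligne1982HodgeCycles, I §3 Prop. 3.6] -/
theorem finrank_hodgeLie_inf_endAlg_comapEquiv (H : HodgeStructure W n) (e : V ≃ₗ[ℚ] W) :
    Module.finrank ℚ ↥((H.comapEquiv e).hodgeLie ⊓ Subalgebra.toSubmodule (H.comapEquiv e).endAlg) =
      Module.finrank ℚ ↥(H.hodgeLie ⊓ Subalgebra.toSubmodule H.endAlg) := by
  rw [hodgeLie_inf_endAlg_comapEquiv_eq_map_conj, LinearEquiv.finrank_map_eq]

/-- **`[𝔥, 𝔥](e^* H) = e⁻¹ [𝔥, 𝔥](H) e`** for the derived algebra `span {XY − YX}` of the Hodge Lie algebra (conjugation is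
multiplicative and maps `𝔥(H)` onto `𝔥(e^* H)`, `hodgeLie_comapEquiv_eq_map_conj`). [cite: Moonen1999MTNotes, (1.7) and (1.8)]
[cite: Deligne1982HodgeCycles, I §3 Prop. 3.6] -/
theorem hodgeLie_derived_comapEquiv_eq_map_conj (H : HodgeStructure W n) (e : V ≃ₗ[ℚ] W) :
    Submodule.span ℚ {B | ∃ X ∈ (H.comapEquiv e).hodgeLie, ∃ Y ∈ (H.comapEquiv e).hodgeLie, X * Y - Y * X = B} =
      (Submodule.span ℚ {B | ∃ X ∈ H.hodgeLie, ∃ Y ∈ H.hodgeLie, X * Y - Y * X = B}).map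
        (e.symm.conj : Module.End ℚ W ≃ₗ[ℚ] Module.End ℚ V).toLinearMap := by
  have hconj : ∀ X : Module.End ℚ W, (e.symm.conj : Module.End ℚ W ≃ₗ[ℚ] Module.End ℚ V).toLinearMap X =
      e.symm.toLinearMap ∘ₗ X ∘ₗ e.toLinearMap := fun X => by
    change e.symm.conj X = _
    rw [LinearEquiv.conj_apply, LinearEquiv.symm_symm, LinearMap.comp_assoc]
  have hmul : ∀ X Y : Module.End ℚ W,
      (e.symm.conj : Module.End ℚ W ≃ₗ[ℚ] Module.End ℚ V).toLinearMap (X * Y - Y * X) =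
        (e.symm.conj : Module.End ℚ W ≃ₗ[ℚ] Module.End ℚ V).toLinearMap X *
            (e.symm.conj : Module.End ℚ W ≃ₗ[ℚ] Module.End ℚ V).toLinearMap Y -
          (e.symm.conj : Module.End ℚ W ≃ₗ[ℚ] Module.End ℚ V).toLinearMap Y *
            (e.symm.conj : Module.End ℚ W ≃ₗ[ℚ] Module.End ℚ V).toLinearMap X := fun X Y => by
    rw [hconj, hconj, hconj]
    refine LinearMap.ext fun v => ?_
    simp only [LinearMap.coe_comp, LinearEquiv.coe_coe, Function.comp_apply, LinearMap.sub_apply,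
      Module.End.mul_apply, LinearEquiv.apply_symm_apply, map_sub]
  rw [Submodule.map_span]
  refine congrArg _ (Set.Subset.antisymm ?_ ?_)
  · rintro _ ⟨X, hX, Y, hY, rfl⟩
    rw [hodgeLie_comapEquiv_eq_map_conj'] at hX hY
    obtain ⟨X', hX', rfl⟩ := hX
    obtain ⟨Y', hY', rfl⟩ := hY
    exact ⟨X' * Y' - Y' * X', ⟨X', hX', Y', hY', rfl⟩, hmul X' Y'⟩
  · rintro _ ⟨_, ⟨X', hX', Y', hY', rfl⟩, rfl⟩
    refine ⟨_, ?_, _, ?_, (hmul X' Y').symm⟩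
    · rw [hodgeLie_comapEquiv_eq_map_conj']; exact ⟨X', hX', rfl⟩
    · rw [hodgeLie_comapEquiv_eq_map_conj']; exact ⟨Y', hY', rfl⟩

/-- **`dim_ℚ [𝔥, 𝔥](e^* H) = dim_ℚ [𝔥, 𝔥](H)`** — the dimension of the derived algebra of the Hodge Lie algebra is an
invariant of the isomorphism class of the Hodge structure. [cite: Moonen1999MTNotes, (1.7) and (1.8)]
[cite: Deligne1982HodgeCycles, I §3 Prop. 3.6] -/
theorem finrank_hodgeLie_derived_comapEquiv (H : HodgeStructure W n) (e : V ≃ₗ[ℚ] W) :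
    Module.finrank ℚ ↥(Submodule.span ℚ {B | ∃ X ∈ (H.comapEquiv e).hodgeLie, ∃ Y ∈ (H.comapEquiv e).hodgeLie,
      X * Y - Y * X = B}) =
      Module.finrank ℚ ↥(Submodule.span ℚ {B | ∃ X ∈ H.hodgeLie, ∃ Y ∈ H.hodgeLie, X * Y - Y * X = B}) := by
  rw [hodgeLie_derived_comapEquiv_eq_map_conj, LinearEquiv.finrank_map_eq]

end Transport

/-! ### §2 The diagonal: `𝔷(H^{⊕ι}) = Δ 𝔷(H)`, `[𝔥, 𝔥](H^{⊕ι}) = Δ [𝔥, 𝔥](H)` -/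

section PiConst

universe u

variable {ι : Type} [Fintype ι] [DecidableEq ι] {V : Type u} [AddCommGroup V] [Module ℚ V] [Module.Finite ℚ V]
  [HodgeTensorFacts.{u, u}] {n : ℤ} (H : HodgeStructure V n)

omit [Module.Finite ℚ V] [HodgeTensorFacts.{u, u}] in
/-- The diagonal operator acts coordinatewise: `Δ(Y) v = (Y v_i)_i`. [folklore] -/
private theorem diag_apply (Y : Module.End ℚ V) (v : ι → V) :
    (∑ i, LinearMap.single ℚ (fun _ : ι => V) i ∘ₗ Y ∘ₗ LinearMap.proj i) v = fun i => Y (v i) := by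
  simp only [LinearMap.sum_apply, LinearMap.comp_apply, LinearMap.coe_single, LinearMap.proj_apply]
  exact Finset.univ_sum_single _

omit [Module.Finite ℚ V] [HodgeTensorFacts.{u, u}] in
/-- `pr_j Δ(Y) in_j = Y`. [folklore] -/
private theorem proj_diag_single (Y : Module.End ℚ V) (j : ι) :
    LinearMap.proj j ∘ₗ (∑ i, LinearMap.single ℚ (fun _ : ι => V) i ∘ₗ Y ∘ₗ LinearMap.proj i) ∘ₗ
      LinearMap.single ℚ (fun _ : ι => V) j = Y := by
  refine LinearMap.ext fun v => ?_
  rw [LinearMap.comp_apply, LinearMap.comp_apply, diag_apply]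
  simp only [LinearMap.proj_apply, LinearMap.coe_single, Pi.single_eq_same]

omit [Module.Finite ℚ V] [HodgeTensorFacts.{u, u}] in
/-- `Δ` is multiplicative. [folklore] -/
private theorem diag_mul (X Y : Module.End ℚ V) :
    (∑ i, LinearMap.single ℚ (fun _ : ι => V) i ∘ₗ (X * Y) ∘ₗ LinearMap.proj i) =
      (∑ i, LinearMap.single ℚ (fun _ : ι => V) i ∘ₗ X ∘ₗ LinearMap.proj i) *
        ∑ i, LinearMap.single ℚ (fun _ : ι => V) i ∘ₗ Y ∘ₗ LinearMap.proj i := by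
  refine LinearMap.ext fun v => ?_
  rw [Module.End.mul_apply, diag_apply, diag_apply, diag_apply]
  rfl

omit [Module.Finite ℚ V] [HodgeTensorFacts.{u, u}] in
/-- **`Δ(a) ∈ End_Hdg(H^{⊕ι})` for `a ∈ End_Hdg(H)`** (`Δ(a) = Σ_i in_i a pr_i`, a sum of composites of morphisms).
[cite: Huybrechts2016K3, §3.3.3] -/
theorem diagonal_mem_endAlg_pi_const {a : Module.End ℚ V} (ha : a ∈ H.endAlg) :
    (∑ i, LinearMap.single ℚ (fun _ : ι => V) i ∘ₗ a ∘ₗ LinearMap.proj i) ∈ (pi fun _ : ι => H).endAlg := by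
  refine Subalgebra.sum_mem _ fun i _ => ?_
  exact Hom.toLinearMap_mem_endAlg
    ((Hom.piSingle (fun _ : ι => H) i).comp ((endAlg.toHom ⟨a, ha⟩).comp (Hom.piProj (fun _ : ι => H) i)))

omit [Module.Finite ℚ V] [HodgeTensorFacts.{u, u}] in
/-- **`pr_j X in_j ∈ End_Hdg(H)` for `X ∈ End_Hdg(H^{⊕ι})`.** [cite: Huybrechts2016K3, §3.3.3] -/
theorem proj_comp_comp_single_mem_endAlg {X : Module.End ℚ (ι → V)} (hX : X ∈ (pi fun _ : ι => H).endAlg) (j : ι) :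
    LinearMap.proj j ∘ₗ X ∘ₗ LinearMap.single ℚ (fun _ : ι => V) j ∈ H.endAlg :=
  Hom.toLinearMap_mem_endAlg
    ((Hom.piProj (fun _ : ι => H) j).comp ((endAlg.toHom ⟨X, hX⟩).comp (Hom.piSingle (fun _ : ι => H) j)))

/-- **`𝔷(H^{⊕ι}) = Δ 𝔷(H)`** for `ι` nonempty: `X ∈ 𝔥(⊕ H) ∩ End_Hdg(⊕ H)` is the diagonal of `pr_j X in_j ∈ 𝔥(H) ∩ End_Hdg(H)`
(`eq_sum_single_comp_comp_proj_of_mem_hodgeLie_pi_const`), and conversely. [cite: Moonen1999MTNotes, (1.7) and (1.8)]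
[cite: MoonenZarhin1999LowDim, §1] -/
theorem hodgeLie_inf_endAlg_pi_const_eq_image_diagonal [Nonempty ι] :
    (((pi fun _ : ι => H).hodgeLie ⊓ Subalgebra.toSubmodule (pi fun _ : ι => H).endAlg :
        Submodule ℚ (Module.End ℚ (ι → V))) : Set (Module.End ℚ (ι → V))) =
      (fun Y : Module.End ℚ V => ∑ i, LinearMap.single ℚ (fun _ : ι => V) i ∘ₗ Y ∘ₗ LinearMap.proj i) ''
        ((H.hodgeLie ⊓ Subalgebra.toSubmodule H.endAlg : Submodule ℚ (Module.End ℚ V)) :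
          Set (Module.End ℚ V)) := by
  obtain ⟨j₀⟩ := ‹Nonempty ι›
  refine Set.Subset.antisymm (fun X hX => ?_) ?_
  · obtain ⟨hX𝔥, hXe⟩ := Submodule.mem_inf.1 hX
    refine ⟨_, Submodule.mem_inf.2 ⟨proj_comp_single_mem_hodgeLie_pi (fun _ : ι => H) j₀ hX𝔥,
      (Subalgebra.mem_toSubmodule _).2
        (proj_comp_comp_single_mem_endAlg H ((Subalgebra.mem_toSubmodule _).1 hXe) j₀)⟩,
      (eq_sum_single_comp_comp_proj_of_mem_hodgeLie_pi_const H hX𝔥 j₀).symm⟩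
  · rintro _ ⟨Y, hY, rfl⟩
    obtain ⟨hY𝔥, hYe⟩ := Submodule.mem_inf.1 hY
    exact Submodule.mem_inf.2 ⟨sum_single_comp_comp_proj_mem_hodgeLie_pi_const H hY𝔥,
      (Subalgebra.mem_toSubmodule _).2 (diagonal_mem_endAlg_pi_const H ((Subalgebra.mem_toSubmodule _).1 hYe))⟩

/-- **`dim_ℚ 𝔷(H^{⊕ι}) = dim_ℚ 𝔷(H)`** for `ι` finite nonempty — the centre of the Hodge Lie algebra does not change under
`H ↦ H^{⊕ι}` (for abelian varieties: the type-IV part of `Hg(Bⁿ)` is that of `Hg(B)`). [cite: Moonen1999MTNotes, (1.7) and (1.8)]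
[cite: MoonenZarhin1999LowDim, §1] -/
theorem finrank_hodgeLie_inf_endAlg_pi_const_eq [Nonempty ι] :
    Module.finrank ℚ ↥((pi fun _ : ι => H).hodgeLie ⊓ Subalgebra.toSubmodule (pi fun _ : ι => H).endAlg) =
      Module.finrank ℚ ↥(H.hodgeLie ⊓ Subalgebra.toSubmodule H.endAlg) := by
  obtain ⟨j₀⟩ := ‹Nonempty ι›
  let Δ₀ : Module.End ℚ V →ₗ[ℚ] Module.End ℚ (ι → V) :=
    { toFun := fun Y => ∑ i, LinearMap.single ℚ (fun _ : ι => V) i ∘ₗ Y ∘ₗ LinearMap.proj i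
      map_add' := fun Y Z => by simp only [LinearMap.comp_add, LinearMap.add_comp, Finset.sum_add_distrib]
      map_smul' := fun c Y => by
        simp only [LinearMap.comp_smul, LinearMap.smul_comp, RingHom.id_apply, Finset.smul_sum] }
  have hinj : Function.Injective Δ₀ := fun Y Z hYZ => by
    rw [← proj_diag_single Y j₀, ← proj_diag_single Z j₀]
    exact congrArg (fun X => LinearMap.proj j₀ ∘ₗ X ∘ₗ LinearMap.single ℚ (fun _ : ι => V) j₀) hYZ
  have heq : (pi fun _ : ι => H).hodgeLie ⊓ Subalgebra.toSubmodule (pi fun _ : ι => H).endAlg =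
      (H.hodgeLie ⊓ Subalgebra.toSubmodule H.endAlg).map Δ₀ := by
    refine SetLike.coe_injective ?_
    rw [Submodule.map_coe, hodgeLie_inf_endAlg_pi_const_eq_image_diagonal H]
    rfl
  rw [heq]
  exact ((Submodule.equivMapOfInjective Δ₀ hinj _).finrank_eq).symm

/-- **`[𝔥, 𝔥](H^{⊕ι}) = Δ [𝔥, 𝔥](H)`** for `ι` nonempty (`Δ` is multiplicative and maps `𝔥(H)` onto `𝔥(H^{⊕ι})`).
[cite: Moonen1999MTNotes, (1.7) and (1.8)] [cite: MoonenZarhin1999LowDim, §1] -/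
theorem hodgeLie_derived_pi_const_eq_image_diagonal [Nonempty ι] :
    ((Submodule.span ℚ {B | ∃ X ∈ (pi fun _ : ι => H).hodgeLie, ∃ Y ∈ (pi fun _ : ι => H).hodgeLie,
        X * Y - Y * X = B}) : Set (Module.End ℚ (ι → V))) =
      (fun Y : Module.End ℚ V => ∑ i, LinearMap.single ℚ (fun _ : ι => V) i ∘ₗ Y ∘ₗ LinearMap.proj i) ''
        (Submodule.span ℚ {B | ∃ X ∈ H.hodgeLie, ∃ Y ∈ H.hodgeLie, X * Y - Y * X = B} : Set (Module.End ℚ V)) := by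
  obtain ⟨j₀⟩ := ‹Nonempty ι›
  let Δ₀ : Module.End ℚ V →ₗ[ℚ] Module.End ℚ (ι → V) :=
    { toFun := fun Y => ∑ i, LinearMap.single ℚ (fun _ : ι => V) i ∘ₗ Y ∘ₗ LinearMap.proj i
      map_add' := fun Y Z => by simp only [LinearMap.comp_add, LinearMap.add_comp, Finset.sum_add_distrib]
      map_smul' := fun c Y => by
        simp only [LinearMap.comp_smul, LinearMap.smul_comp, RingHom.id_apply, Finset.smul_sum] }
  have hΔ₀ : ∀ Y, Δ₀ Y = ∑ i, LinearMap.single ℚ (fun _ : ι => V) i ∘ₗ Y ∘ₗ LinearMap.proj i := fun _ => rfl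
  have hmul : ∀ X Y : Module.End ℚ V, Δ₀ (X * Y - Y * X) = Δ₀ X * Δ₀ Y - Δ₀ Y * Δ₀ X := fun X Y => by
    rw [map_sub]
    simp only [hΔ₀, diag_mul]
  change _ = Δ₀ '' _
  rw [← Submodule.map_coe, Submodule.map_span]
  congr 1
  refine congrArg _ (Set.Subset.antisymm ?_ ?_)
  · rintro _ ⟨X, hX, Y, hY, rfl⟩
    refine ⟨_, ⟨_, proj_comp_single_mem_hodgeLie_pi (fun _ : ι => H) j₀ hX, _,
      proj_comp_single_mem_hodgeLie_pi (fun _ : ι => H) j₀ hY, rfl⟩, ?_⟩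
    rw [hmul, hΔ₀, hΔ₀, ← eq_sum_single_comp_comp_proj_of_mem_hodgeLie_pi_const H hX j₀,
      ← eq_sum_single_comp_comp_proj_of_mem_hodgeLie_pi_const H hY j₀]
  · rintro _ ⟨_, ⟨X, hX, Y, hY, rfl⟩, rfl⟩
    exact ⟨Δ₀ X, by rw [hΔ₀]; exact sum_single_comp_comp_proj_mem_hodgeLie_pi_const H hX, Δ₀ Y,
      by rw [hΔ₀]; exact sum_single_comp_comp_proj_mem_hodgeLie_pi_const H hY, (hmul X Y).symm⟩

/-- **`dim_ℚ [𝔥, 𝔥](H^{⊕ι}) = dim_ℚ [𝔥, 𝔥](H)`** for `ι` finite nonempty — the derived (semisimple) part of the Hodge Lie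
algebra does not change under `H ↦ H^{⊕ι}`. [cite: Moonen1999MTNotes, (1.7) and (1.8)] [cite: MoonenZarhin1999LowDim, §1] -/
theorem finrank_hodgeLie_derived_pi_const_eq [Nonempty ι] :
    Module.finrank ℚ ↥(Submodule.span ℚ {B | ∃ X ∈ (pi fun _ : ι => H).hodgeLie, ∃ Y ∈ (pi fun _ : ι => H).hodgeLie,
        X * Y - Y * X = B}) =
      Module.finrank ℚ ↥(Submodule.span ℚ {B | ∃ X ∈ H.hodgeLie, ∃ Y ∈ H.hodgeLie, X * Y - Y * X = B}) := by
  obtain ⟨j₀⟩ := ‹Nonempty ι›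
  let Δ₀ : Module.End ℚ V →ₗ[ℚ] Module.End ℚ (ι → V) :=
    { toFun := fun Y => ∑ i, LinearMap.single ℚ (fun _ : ι => V) i ∘ₗ Y ∘ₗ LinearMap.proj i
      map_add' := fun Y Z => by simp only [LinearMap.comp_add, LinearMap.add_comp, Finset.sum_add_distrib]
      map_smul' := fun c Y => by
        simp only [LinearMap.comp_smul, LinearMap.smul_comp, RingHom.id_apply, Finset.smul_sum] }
  have hinj : Function.Injective Δ₀ := fun Y Z hYZ => by
    rw [← proj_diag_single Y j₀, ← proj_diag_single Z j₀]
    exact congrArg (fun X => LinearMap.proj j₀ ∘ₗ X ∘ₗ LinearMap.single ℚ (fun _ : ι => V) j₀) hYZ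
  have heq : Submodule.span ℚ {B | ∃ X ∈ (pi fun _ : ι => H).hodgeLie, ∃ Y ∈ (pi fun _ : ι => H).hodgeLie,
        X * Y - Y * X = B} =
      (Submodule.span ℚ {B | ∃ X ∈ H.hodgeLie, ∃ Y ∈ H.hodgeLie, X * Y - Y * X = B}).map Δ₀ := by
    refine SetLike.coe_injective ?_
    rw [Submodule.map_coe, hodgeLie_derived_pi_const_eq_image_diagonal H]
    rfl
  rw [heq]
  exact ((Submodule.equivMapOfInjective Δ₀ hinj _).finrank_eq).symm

end PiConst

end HodgeStructure

end Literature.AlgebraicGeometry.Motives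

end
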